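import Mathlib
import HarnessLib
import HarnessLib.Audit
import Summits.Langlands.Statement
import HarnessLib.Audit.Status.Attr

/-!
Route: SteinbergArtinDedekind

# Route SteinbergArtinDedekind — Steinberg–Artin family St∘ρ̄ — free residual automorphy at p = ℓ,
Artin-weight lifting, ζ_ℚ(C)/ζ automorphic

It suffices to show X ∧ J. X (SteinbergStrongArtin, the card's family): for every prime ℓ ≥ 5, every
continuous surjective ODD
ρ̄ : Γ_ℚ → GL₂(𝔽_ℓ) and every continuous σ : Γ_ℚ → GL_ℓ(ℂ) carrying the STEINBERG CHARACTER of ρ̄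
(tr σ(g) = #(ρ̄(g)-stable lines
in 𝔽_ℓ²) − 1, i.e. σ ≅ St_ℓ∘ρ̄, the ℓ-dimensional constituent of ℂ[P¹(𝔽_ℓ)]) there is a cuspidal
automorphic representation π of
GL_ℓ(𝔸_ℚ) whose Satake parameters match the Frobenius characteristic polynomials of σ at all but
finitely many places — equivalently
ζ_K(s)/ζ(s) is the standard L-function of a cusp form on GL_ℓ/ℚ for every degree-(ℓ+1) field K =
ℚ(C) cut out by a Borel subgroup
(C ⊂ E[ℓ] a cyclic subgroup when ρ̄ = ρ̄_E,ℓ: "ζ of the ℓ-isogeny field over ζ is automorphic"). X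
is attacked as
ArtinWeightLifting ∘ ResidualRegularLift (free residual automorphy in regular weight at p = ℓ, then
Artin-weight lifting).
J (SteinbergArtinJunction): X → Langlands, the declared out-of-scope remainder of the summit (X is
an infinite explicit family of
instances of conjunct (B) at F = ℚ, n = ℓ, Hodge–Tate type 0; J is never glue and is not staffed
from this route). Card realised:
steinberg-artin-dedekind (spine, sole card). Conforming re-open (D-0027 §2.1) of the retired
route-Langlands-SteinbergArtin, whose
Assembly ended in X.
Lean: `SteinbergStrongArtin ∧ SteinbergArtinJunction`

## Assembly
Pure logic, certified by the deciding theorem `closes (hLift : ArtinWeightLifting) (hRes :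
ResidualRegularLift) (hJ : SteinbergArtinJunction) :
Langlands := hJ (fun ℓ _ hℓ ρ σ hs ho hc => hLift ℓ hℓ ρ σ hs ho hc (hRes ℓ hℓ ρ σ hs ho hc))`
(glue.lean; rc 0 in Sketch.lean, axioms
propext / Classical.choice / Quot.sound): fix (ℓ, ρ̄, σ); ResidualRegularLift supplies the
weight-zero cuspidal Π congruent to σ,
ArtinWeightLifting turns it into the cuspidal π matching σ — this is X (`target_of_cruxes` in
Sketch.lean; X also specialises to RungFive and
RungSeven by `omega`); SteinbergArtinJunction carries X to the summit constant. The mathematical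
content is ArtinWeightLifting (rank 2) and its
foreseen children; the junction is the declared, not-claimed complement.

Rationale: WHY THIS LINE. Mechanism (card steinberg-artin-dedekind): in DEFINING characteristic the Steinberg
lattice reduces to the Steinberg module
St ⊗ 𝔽_ℓ ≅ Sym^(ℓ−1)(𝔽_ℓ²) = L(ℓ−1) (irreducible and projective; Humphreys2005 Ch. 9), so σ̄ ≅
Sym^(ℓ−1)ρ̄ = the reduction of
Sym^(ℓ−1)ρ_g for a weight-2 non-CM newform g with ρ̄_g ≅ ρ̄ (KhareWintenberger2009, AshStevens1986),
automorphic of weight zero on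
GL_ℓ/ℚ by NewtonThorneIHES2021b: residual automorphy in REGULAR weight is free, with adequate image
although p = ℓ = n
(GuralnickHerzigTiep2017 Thm 1.7 / Cor 9.4); σ is odd (tr σ(c) = 1), orthogonal, absolutely
irreducible, potentially unramified at ℓ,
so EVERY hypothesis of polarized automorphy lifting holds except distinctness of Hodge–Tate weights
(all 0): the line isolates
NonRegularWeightBarrier on one clean family and attacks it ℓ-adically at p = ℓ — big R = 𝕋 / density
of automorphic points for
Sym^(ℓ−1)ρ̄|G_M over an imaginary quadratic M (Allen2019 Thm 1 with p ∤ 2n replaced by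
Thorne2017TwoAdic Thm 5.1;
HellmannMargerinSchraen2022), then an Artin-weight classicality step on the definite unitary group
U(ℓ), for which the GL₂/ℚ template is
Pan2022 (Fontaine–Mazur at Hodge–Tate weights (0,0) through Sen theory at singular infinitesimal
character) and whose step zero over CM
fields is now in print: arXiv:2605.03519 (2026) proves the Dospinescu–Paškūnas–Schraen
infinitesimal-character conjecture for the
completed cohomology of GL_n over CM fields at non-Eisenstein decomposed-generic 𝔪 — our 𝔪 =
𝔪(Sym^(ℓ−1)ρ̄|G_M) qualifies (absolutely
irreducible; a decomposed-generic auxiliary prime exists: Frob_q generating the non-split torus of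
GL₂(𝔽_ℓ) gives eigenvalue ratios in
μ_(ℓ+1) ∖ 𝔽_ℓ and q ≢ ±1 mod ℓ). Imported areas: modular representation theory of finite groups of
Lie type (defining-characteristic
reduction, adequacy in dimension p), deformation theory / patching, locally analytic completed
cohomology; the Dedekind-zeta identity
makes outputs numerically checkable (LMFDB isogeny fields). Calibration: ℓ = 5 is
Calegari2013ArtinS5 (PGL₂(𝔽₅) ≅ S₅; the
5-dimensional Steinberg constituent is exactly where that paper is conditional). What this route
does that the retired
route-Langlands-SteinbergArtin did not: a deciding theorem `closes : ArtinWeightLifting →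
ResidualRegularLift →
SteinbergArtinJunction → Langlands` (pure logic, certified), the rung RungSeven (first rung where
PGL₂(𝔽_ℓ) is not an alternating or
symmetric group), and the 2026 infinitesimal-character input; negatives index (1 entry, K3
Kuga–Satake anchor) untouched.

RANKED CRUXES. #0 SteinbergStrongArtin (target) — X as in § Thesis (all primes ℓ ≥ 5; ρ̄ surjective
and odd; σ pinned up to conjugacy by the Steinberg character; conclusion = a.e. Satake–Frobenius
matching with a cuspidal π on GL_ℓ/ℚ, the `IsPiOfArtinRep` shape spelled out). (why it might fail:
False only if conjunct (B) fails for some St∘ρ̄ (nobody expects); as a METHOD target every known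
lifting/interpolation technique needs distinct Hodge–Tate weights or a limit-of-discrete-series
host, and σ has neither (HT = 0^ℓ; inf. char. singular on U(a,b) and Sp_(ℓ−1)).)
[Calegari2013ArtinS5, NewtonThorneIHES2021b, CalegariGeraghty2017,
Literature.Barriers.Langlands.NonRegularWeightBarrier]
#2 ArtinWeightLifting (crux) — ARTIN-WEIGHT AUTOMORPHY LIFTING FOR THE STEINBERG FAMILY (card
S2+S3): for ℓ ≥ 5, ρ̄ surjective odd, σ with the Steinberg character of ρ̄ — IF σ is congruent
modulo a prime 𝔩 ∣ ℓ of ℤ̄ ⊂ ℂ to a weight-zero (cohomological, trivial coefficients) cuspidal Π on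
GL_ℓ(𝔸_ℚ) (Hecke polynomial of Π_p ≡ charpoly σ(Frob_p) mod 𝔩 for almost all p), THEN σ is
automorphic (a.e. Satake–Frobenius matching with a cuspidal π on GL_ℓ/ℚ). The hypothesis is a
theorem on paper (ResidualRegularLift); the content is lifting from HT weights (0,1,…,ℓ−1) to
(0,…,0) at p = ℓ = n, foreseen as ProAutomorphyBigRT (filed informal, rank 3) →
ArtinWeightClassicality. [difficulty: open-problem] (why it might fail: Automorphy lifting to EQUAL
Hodge–Tate weights at p = ℓ = n: patching needs cohomology in l₀ > 0 degrees that Artin-type π on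
GL_ℓ (ℓ ≥ 3) lacks (not even coherent), σ|D_ℓ is not trianguline in the niveau-2 regime, and weight
−ρ has no classicality theorem on U(ℓ).) [CalegariGeraghty2017, BarnetlambEtAl2014,
Thorne2017TwoAdic, Allen2019, HellmannMargerinSchraen2022, Pan2022, arXiv:2605.03519,
Literature.Barriers.Langlands.NonRegularWeightBarrier]
#4 RungFive (crux) — FIRST RUNG: the target at ℓ = 5 (PGL₂(𝔽₅) ≅ S₅; σ = Calegari's ρ₅): for every
odd surjective ρ̄ : Γ_ℚ → GL₂(𝔽₅), St∘ρ̄ is automorphic on GL₅/ℚ unconditionally.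
Calegari2013ArtinS5 Thm 1.2 proves it when the S₅-closure is unramified at 5 with Frob₅ ∈ 2B AND
ζ_H(s) ≠ 0 for s ∈ (0,1), H the degree-12 field (verified by Booker for one field); for ρ̄ = ρ̄_E,5
the closure contains ℚ(√5) and is ramified at 5, so even his hypotheses are not met. [difficulty: L]
(why it might fail: Removing 'ζ_H ≠ 0 on (0,1)' needs either real-zero-freeness of degree-12
Dedekind zetas uniformly (not implied by GRH alone) or a non-analytic identification of Calegari's
weak transfer ϖ with ρ₅ on the density-zero exceptional set; both are open.) [Calegari2013ArtinS5,
arXiv:1112.1152, Kim2002, KhareThorne2017, Booker2006]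
#5 RungSeven (crux) — SECOND RUNG, the first with no exceptional isomorphism to an
alternating/symmetric group: the target at ℓ = 7 — for every odd surjective ρ̄ : Γ_ℚ → GL₂(𝔽₇),
St∘ρ̄ (dimension 7, projective image PGL₂(𝔽₇)) is automorphic on GL₇/ℚ; equivalently ζ_K/ζ is a
GL₇/ℚ standard L-function for the octic 7-isogeny fields K (first test: E = 11a1, the auditor's
suggested L-function). Only the ℓ-adic door is free here: PSL₂(𝔽₇) ≅ GL₃(𝔽₂) makes St₇ mod 2 = 1 +
(V₃ ⊕ V₃*) Eisenstein (Brauer characters (7,1,0,0) on the 2-regular classes), and St₇ mod 3 is the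
7-dimensional irreducible of the defect-1 principal block — neither is residually automorphic for
free. [difficulty: open-problem] (why it might fail: No S₅/icosahedral crutch: nothing beyond
residual automorphy mod 7 is known for PGL₂(𝔽₇)-closures; even Artin holomorphy of ζ_K/ζ for these
octic fields is open (no sub-solvable tower: Uchida–van der Waall do not apply), so a
converse-theorem fallback is unavailable too.) [Calegari2013ArtinS5, NewtonThorneIHES2021b,
GuralnickHerzigTiep2017, doi:10.1090/bull/1492]
#9 SteinbergCongruence (support) — DEFINING-CHARACTERISTIC MIRACLE (card claim (c)) in
Brauer–Nesbitt-ready form: if σ has the Steinberg character of ρ̄ then for every g the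
characteristic polynomial of σ(g) lies in ℤ[X] and reduces mod ℓ to ∏_(i=0)^(ℓ−1) (X − a^i
b^(ℓ−1−i)), (a, b) the eigenvalues of ρ̄(g) in any field over 𝔽_ℓ — i.e. σ̄^ss ≅ Sym^(ℓ−1)ρ̄ (St ⊗
𝔽_ℓ = L(ℓ−1)). Finite group theory on the four class types of GL₂(𝔽_ℓ); provable now. [difficulty:
provable-now] [Humphreys2005, GuralnickHerzigTiep2017, SerreLinearRepresentations1977]
#9 ResidualRegularLift (support) — FREE RESIDUAL AUTOMORPHY: for ℓ ≥ 5, ρ̄ surjective odd, σ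
Steinberg-of-ρ̄, there is a weight-zero cuspidal Π on GL_ℓ(𝔸_ℚ) congruent to σ modulo a prime over ℓ
(= the hypothesis of ArtinWeightLifting). On paper: ρ̄ ≅ ρ̄_g for a weight-2 newform g of level
N(ρ̄)ℓ² (KhareWintenberger2009; AshStevens1986 Thm 3.5), g non-CM (im ρ̄ ⊇ SL₂(𝔽_ℓ)); Π :=
Sym^(ℓ−1)π_g is cuspidal of weight zero (NewtonThorneIHES2021b Thm A; HT 0,…,ℓ−1) with integral
Hecke polynomial ≡ Sym^(ℓ−1) charpoly ρ̄(Frob_p) ≡ charpoly σ(Frob_p) (SteinbergCongruence). Stated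
fact-free (no named-fact hypotheses) to keep the cone clean; dischargeable in Lean once Serre's
conjecture and Sym^n automorphy are. [difficulty: L] [KhareWintenberger2009, AshStevens1986,
NewtonThorneIHES2021b, NewtonThorneIHES2021a]
#9 SteinbergArtinExists (support) — CONSTRUCTION (never smuggled into the interface): for every
continuous ρ̄ : Γ_ℚ → GL₂(𝔽_ℓ) there is a continuous σ : Γ_ℚ → GL_ℓ(ℂ) with the Steinberg character
of ρ̄ — σ = (ℂ[P¹(𝔽_ℓ)] ⊖ 𝟙)∘ρ̄ in any basis; continuity because ρ̄ has open kernel. Makes the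
family non-empty; the character pins σ up to GL_ℓ(ℂ)-conjugacy. [difficulty: provable-now]
[SerreLinearRepresentations1977, Humphreys2005]
#9 RungFiveWeak (support) — CALIBRATION (ℓ = 5, weak form): for odd surjective ρ̄ : Γ_ℚ → GL₂(𝔽₅)
there is a cuspidal ϖ on GL₅/ℚ matching σ = St∘ρ̄ at a set of finite places of natural density one.
Calegari2013ArtinS5 Thm 1.1 gives this for closures unramified at 5 with Frob₅ ∈ 2B and says the
local condition at 5 'is not essential to the method'; it entered through Sasaki's theorems and
should disappear with Pilloni–Stroh 2016 / Sasaki 2019 (p ramified allowed). Known on paper modulo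
that substitution; the rung below RungFive. [difficulty: M] [Calegari2013ArtinS5, Kim2002,
doi:10.1007/s00222-018-0825-x, doi:10.4171/dm/419]
#9 SteinbergArtinJunction (support) — OUT-OF-SCOPE REMAINDER, filed only so that the deciding
theorem honestly ends at the summit: SteinbergStrongArtin → Langlands. It contains everything this
thesis does NOT claim: in the sector, the upgrade of a.e. Satake matching to `Corresponds`
(local–global compatibility at every finite place + strong multiplicity one) and the Galois side of
(A) for the π produced; outside it, all other n, F, weights, direction (A) and the reciprocity data
𝓡. Never glue; not to be staffed from this route; shared junction for any card on the Steinberg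
family. [difficulty: open-problem] [BuzzardGeeLMS2014, FontaineMazurGeometric1995,
ArthurClozelAMS120]

TWO-LAYER PLAN. ArtinWeightLifting ⇐ ProAutomorphyBigRT → ArtinWeightClassicality →
ArtinWeightLifting (k = 2): ProAutomorphyBigRT is filed now as an
informal rank-3 crux (every irreducible component of Spec R^pol_S(Sym^(ℓ−1)ρ̄|G_M) has an
automorphic point, hence R^(pol,red) = 𝕋^big_𝔪 of the
definite unitary group U(ℓ) split by an imaginary quadratic M, niveau-2 regime, p = ℓ = n; Allen2019
/ Thorne2017TwoAdic / HellmannMargerinSchraen2022);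
ArtinWeightClassicality ('an 𝒪-point of 𝕋^big_𝔪(U(ℓ)) with Hodge–Tate weights 0 and finite monodromy
is classical of Artin type and descends
to GL_ℓ/ℚ') is typed when completed cohomology of U(ℓ) has a carrier; its template is Pan2022
(GL₂/ℚ, HT (0,0)) and its step zero over M is
arXiv:2605.03519 (locally analytic 𝔪-part of completed cohomology of GL_ℓ/M has the generalized
Hodge–Tate–Sen infinitesimal character,
here the SINGULAR one). SteinbergStrongArtin ⇐ niveau-2 regime (ρ̄|G_ℚℓ irreducible) → ordinary
regime → X. RungFive ⇐ RungFiveWeak →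
identification on the density-zero exceptional set → RungFive.

KILL CRITERIA. (i) An irreducible component of Spec R^pol(Sym^(ℓ−1)ρ̄|G_M) without automorphic
points for some niveau-2 (ℓ, ρ̄) (a genuine p = n obstruction)
refutes ProAutomorphyBigRT and closes the ℓ-adic line (close exhausted: there is no p ≠ ℓ door — σ
mod p ≠ ℓ is an insoluble ℓ-dimensional
representation with no free residual automorphy; at ℓ = 7, mod 2 it is even Eisenstein). (ii) A
theorem that Artin-weight points of
𝕋^big(U(n)), n ≥ 3, are isolated from classical points in every usable sense kills
ArtinWeightLifting as a method (route dormant; X survives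
as the typed acid-family target). (iii) RungFive or RungSeven refuted (some St∘ρ̄ provably
non-automorphic, e.g. a certified pole of ζ_ℚ(C)/ζ)
refutes X and conjunct (B) itself: close refuted:RungFive / refuted:RungSeven and hand the witness
to the summit. (iv) X proved elsewhere
(non-solvable base change / trace-formula breakthrough) moots the route; SteinbergArtinJunction is
shared fate with the whole summit.

NOT DECOMPOSED YET. Local engineering at ℓ (solvable CM base change killing ρ̄(I_ℓ) while keeping a
Frobenius of order ℓ+1 mod centre, so that σ becomes unramified
above ℓ with regular semisimple Frobenius); the ordinary regime (Hom(r̄_v, r̄_v(1)) may be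
non-zero); potential diagonalisability of
Sym^(ℓ−1)ρ_g one step outside the Fontaine–Laffaille range (HT range ℓ−1 = p−1); the descent M → ℚ
(Arthur–Clozel, routine given
cuspidality); the Dedekind face 'ζ_ℚ(C)/ζ entire' (Artin holomorphy for σ: open for
PGL₂(𝔽_ℓ)-closures, known for sub-solvable closures only,
doi:10.1090/bull/1492) — a consequence of X usable as a refuter's numerical handle, deliberately not
an item (its carrier
`artinLFunction`/`HasEntireContinuation` lives in a module with unproved named facts that we keep
out of the cone); oddness / orthogonality /
irreducibility of σ (provable-now lemmas) ride with SteinbergCongruence via --supports; the second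
door at ℓ = 7 (PSL₂(𝔽₇) ≅ GL₃(𝔽₂),
σ̄₂ = 1 + Ind(Fano representation over ℚ(√−7))) is recorded and NOT pursued (residually reducible,
ResiduallyReducibleBarrier).

CHEAPEST FALSIFIER. Already run by the previous planner seat (recorded in the retired route header):
(1) the card's kill-test (i), adequacy of Sym^(ℓ−1)(SL₂(𝔽_ℓ)) ⊂
GL_ℓ(𝔽̄_ℓ) at p = ℓ, is TRUE for ℓ ≥ 5 (GuralnickHerzigTiep2017 Cor. 9.4: the only non-adequate
SL₂(p)-modules have dimension (p±1)/2;
Thm 1.7 for overgroups in dimension p); (2) 'p ∤ 2n' in Allen2019 Thm 1 is inherited from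
Thorne2012, while Thorne2017TwoAdic Thm 5.1 is stated
for every p with GHT-adequacy. Cheapest remaining: (a) LMFDB/kit sanity for E = 11a1, ℓ = 7: K =
ℚ(C) of degree 8 — check ζ_K/ζ against the
degree-7 functional equation with conductor cond(σ) and Booker-style absence of real-zero/pole
pathology (hub compute-free; not run here);
(b) literature: is an essential use of p ∤ n hiding in the R = 𝕋 statement behind Thorne2017TwoAdic
Cor. 4.3 or in HellmannMargerinSchraen2022's
genericity hypotheses at p = n? (c) is 𝔪(Sym^(ℓ−1)ρ̄_E|G_M) 'decomposed generic' for
arXiv:2605.03519 — yes by the non-split-torus Frobenius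
computed in § Why this line (checked by hand this session).

NUMBERS. dim σ = ℓ; [ℚ(C):ℚ] = ℓ+1; tr σ(c) = 1 (σ(c) ∼ diag(1^((ℓ+1)/2), (−1)^((ℓ−1)/2))); det σ =
quadratic; HT(σ) = (0,…,0); HT(Sym^(ℓ−1)ρ_g) =
(0,1,…,ℓ−1) for g of weight 2 (Fontaine–Laffaille bound p−2 = ℓ−2 exceeded by 1); niveau-2 regime:
σ|I_ℓ = ⊕_(j=1..ℓ) ε^j, ε tame of order
ℓ+1 (multiplicity-free, no cyclotomic shifts, Hom(r̄_v, r̄_v(1)) = 0; inertia order ∤ ℓ−1 ⇒ σ|G_ℚℓ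
not trianguline); adequacy for all ℓ ≥ 5
(GuralnickHerzigTiep2017 Cor 9.4); Allen2019 Thm 1 hypotheses: p ∤ 2n FAILS (p = n), all others
arranged; rungs: ℓ = 5 (dimension 5, sextic K,
PGL₂(𝔽₅) ≅ S₅), ℓ = 7 (dimension 7, octic K, PSL₂(𝔽₇) ≅ GL₃(𝔽₂): St₇ ≡ 1 + 3 + 3̄ mod 2, irreducible
mod 3 and mod 7 = L(6)), ℓ = 11 first rung
with no exceptional isomorphism at all. Items at open: 10 (1 target, 3 typed cruxes, 5 support, 1
assembly) + 1 informal crux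
(ProAutomorphyBigRT, rank 3) filed right after open = 11 ≤ 15.

DEFINITION REQUESTS. None needed for the typed items (FramedGaloisRep, IsOdd, HasSatakeParamAt,
HasHeckePolynomialAt, HasWeightZero, satakePolynomial,
FramedRep.charpoly, CuspidalAutomorphicRepData are accepted declarations; Sketch.lean rc 0).
Deferred (file when ArtinWeightClassicality is
typed): a carrier for the 𝔪-localised big Hecke algebra / completed cohomology of the definite
unitary group U(ℓ)/ℚ split by M (the light
`CompletedCohomology` / `Eigenvariety` modules, per the RuelleTorsionArtinWeight library note, not
`CompletedCohomologyHeckeAlgebraGLn`);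
optional convenience notion steinbergArtinRep (topic Summits/Langlands/Langlands/Theorems): 'the' σ
= (ℂ[P¹(𝔽_ℓ)] ⊖ 𝟙)∘ρ̄, witness of
SteinbergArtinExists.

Novelty: Searches (2026-08-15, this seat): `lit frontier Langlands --since 2022` (30 rows; 1 relevant and
new: arXiv:2605.03519, DPS infinitesimal
characters for completed cohomology of GL_n over CM fields — read pp. 1–3, Thm 1.2); `lit bridges
Langlands --cross any` (30 rows, generic);
`lit search --source zbmath "Artin conjecture icosahedral"` (4: Sasaki 2013/2019,
Booker–Lee–Strömbergsson 2020), `"Dedekind conjecture"` (12,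
none on non-solvable closures), `"Artin conjecture Steinberg representation PGL(2,p) automorphic"`
(0), `"Dedekind conjecture zeta function
quotient entire non-normal extension"` (0); `lit galaxy search "Steinberg representation Artin
conjecture" --star all` (0), `"isogeny field"
--star all` (0), `"Artin's conjecture" --star pdf` (5, none relevant); local searchd rc 75,
OpenAlex/S2 HTTP 429, arXiv connector 0 rows this
hour (logged in NOTES.md). Plus the searches recorded by the previous seat and by novelty audit
aud-20 on the card (zbMATH 'Artin conjecture
Steinberg representation' 2 irrelevant; 'strong Artin conjecture odd orthogonal representations' 0;
'Artin L-function PSL(2,7)' 0; galaxy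
'Artin conjecture for the Steinberg representation' 0; arXiv au:Calegari S₅ 1 = arXiv:1112.1152).
Nearest prior art found: Calegari2013ArtinS5 (arXiv:1112.1152) — the ℓ = 5 rung through PGL₂(𝔽₅) ≅
S₅ with a complex engine (icosahedral ϱ over
ℚ(√5), Kim2002 Sym⁴/∧², L-function identification), conditional exactly on the 5-dimensional
Steinberg constituent; NewtonThorneIHES20  [refs: 2605.03519, 1112.1152, Kim2002, NewtonThorneIHES2021b, GuralnickHerzigTiep2017, Allen2019, HellmannMargerinSchraen2022, Pan2022]

Barriers (technique_class: defining-characteristic-reduction, automorphy-lifting): - technique_class: defining-characteristic-reduction, automorphy-lifting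
- Literature.Barriers.Langlands.NonRegularWeightBarrier: NOT evaded — isolated. σ has HT weights
(0,…,0); the catalogued class sees only regular weights, and σ is not even a limit of discrete
series on any host (U(a,b), Sp_(ℓ−1): infinitesimal character singular), so the coherent evasions
(weight one, CalegariGeraghty2017; BCGP higher Hida theory) do not apply. The bet: on a family where
this is provably the ONLY missing hypothesis, big R = 𝕋 at p = n (ProAutomorphyBigRT) plus
Sen-theoretic classicality at singular infinitesimal character (Pan2022 template, arXiv:2605.03519
input) is the right first test of any Artin-weight technology.
- Literature.Barriers.Langlands.SolvableImageBarrier: met head-on (projective image PGL₂(𝔽_ℓ),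
insoluble for ℓ ≥ 5); evaded at the RESIDUAL level by defining-characteristic reduction (congruence
to Sym^(ℓ−1) of a GL₂ form) instead of base change along the splitting field; not evaded in
characteristic 0 (that is ArtinWeightLifting); SolvableImageBarrierNarrow's non-normal quintic
descent is not used.
- Literature.Barriers.Langlands.ResiduallyReducibleBarrier: evaded mod ℓ — σ̄ = Sym^(ℓ−1)ρ̄ is
absolutely irreducible with adequate image for ℓ ≥ 5 (GuralnickHerzigTiep2017 Cor 9.4; the
Khare–Thorne p = 5 phenomenon lives in dimension (p−1)/2 = 2, not ours); it DOES bite on the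
alternative mod-2 door at ℓ = 7 (σ̄₂ Eisenstein), which is why that door is not an item.
- Literature

History (route lifecycle, newest last):
- 2026-08-16T02:19:05Z · AUTO-CRUX: 1 conjecture-grade item(s) promoted to crux (ResidualRegularLift) — refuter vetting / tiering apply (operator:999:1362873)
- 2026-08-16T16:42:32Z · AUTO-CRUX (backfill): SteinbergArtinJunction — hypotheses of the deciding theorem that nothing in the route derives are cruxes (operator:999:1813213)
- 2026-08-25T07:25:42Z · DORMANT — reconciler: no traction for 7.5 d (last activity item-evidence-added at 2026-08-17T19:05:05Z); parked, not closed — `ledger route dormant route-Langlands-Steinb (operator:999:854799)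
- 2026-08-29T00:29:49Z · REACTIVATED — reconciler: reactivated — activity statement-checked at 2026-08-28T21:32:13Z after parking at 2026-08-25T07:25:42Z (operator:999:81415)

sub-problem: Langlands · status: open · opened planner-plancard-Langlands-Langlands-steinber-ca742ef6-g2-0 2026-08-15T18:43:55Z · rev 3 · ledger route-Langlands-SteinbergArtinDedekind
GENERATED by the gate from the ledger (D-0016/17). Provers cite these decls: `theorem foo : Summit.Langlands.Langlands.Theses.SteinbergArtinDedekind.<Decl> := …` in Summits/Langlands/Langlands/Theorems/<Name>.lean.
-/

namespace Summit.Langlands.Langlands.Theses.SteinbergArtinDedekind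

open scoped BigOperators Topology Manifold Classical MeasureTheory ProbabilityTheory Matrix InnerProductSpace ComplexConjugate ContinuousMap
open Filter Set Function TopologicalSpace MeasureTheory

attribute [summit_statement] _root_.Langlands

/-- item stmt-Langlands-11800 · target · rank 0 · open · by planner
why it might fail: False only if conjunct (B) fails for some St∘ρ̄ (nobody expects); as a METHOD target every known lifting/interpolation technique needs distinct Hodge–Tate weights or a limit-of-discrete-series host, and σ has neither (HT = 0^ℓ; inf. char. singular on U(a,b) and Sp_(ℓ−1)).
sources: Calegari2013ArtinS5, NewtonThorneIHES2021b, CalegariGeraghty2017, Literature.Barriers.Langlands.NonRegularWeightBarrier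
[target] X as in § Thesis (all primes ℓ ≥ 5; ρ̄ surjective and odd; σ pinned up to conjugacy by the
Steinberg character; conclusion = a.e. Satake–Frobenius matching with a cuspidal π on GL_ℓ/ℚ, the
`IsPiOfArtinRep` shape spelled out). -/
@[route_item "route-Langlands-SteinbergArtinDedekind"]
def SteinbergStrongArtin : Prop :=
  ∀ (ℓ : ℕ) [Fact ℓ.Prime], 5 ≤ ℓ → ∀ (ρ : Literature.NumberTheory.GaloisRepresentations.FramedGaloisRep ℚ (ZMod ℓ) 2) (σ : Literature.NumberTheory.GaloisRepresentations.FramedGaloisRep ℚ ℂ ℓ), Function.Surjective ρ → ρ.IsOdd → (∀ g, ((σ g : Matrix (Fin ℓ) (Fin ℓ) ℂ)).trace = ((Nat.card {w : Fin 2 → ZMod ℓ // w ≠ 0 ∧ ∃ a : ZMod ℓ, ((ρ g : Matrix (Fin 2) (Fin 2) (ZMod ℓ))).mulVec w = a • w} : ℂ)) / ((ℓ : ℂ) - 1) - 1) → ∃ (hcpt : Literature.NumberTheory.Automorphic.isCompact_glFiniteIntegralLevel ℓ ℚ) (π : Literature.NumberTheory.Automorphic.CuspidalAutomorphicRepData ℓ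 ℚ hcpt), ∀ᶠ v : IsDedekindDomain.HeightOneSpectrum (NumberField.RingOfIntegers ℚ) in Filter.cofinite, ∃ α : Multiset ℂ, π.1.HasSatakeParamAt v α ∧ σ.IsUnramifiedAt v ∧ σ.HasFrobCharpolyAt v (Literature.NumberTheory.Automorphic.satakePolynomial α)

/-- item stmt-Langlands-11801 · crux · rank 2 · open · by planner
why it might fail: Automorphy lifting to EQUAL Hodge–Tate weights at p = ℓ = n: patching needs cohomology in l₀ > 0 degrees that Artin-type π on GL_ℓ (ℓ ≥ 3) lacks (not even coherent), σ|D_ℓ is not trianguline in the niveau-2 regime, and weight −ρ has no classicality theorem on U(ℓ).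
sources: CalegariGeraghty2017, BarnetlambEtAl2014, Thorne2017TwoAdic, Allen2019, HellmannMargerinSchraen2022, Pan2022
[crux] ARTIN-WEIGHT AUTOMORPHY LIFTING FOR THE STEINBERG FAMILY (card S2+S3): for ℓ ≥ 5, ρ̄
surjective odd, σ with the Steinberg character of ρ̄ — IF σ is congruent modulo a prime 𝔩 ∣ ℓ of ℤ̄
⊂ ℂ to a weight-zero (cohomological, trivial coefficients) cuspidal Π on GL_ℓ(𝔸_ℚ) (Hecke polynomial
of Π_p ≡ charpoly σ(Frob_p) mod 𝔩 for almost all p), THEN σ is automorphic (a.e. Satake–Frobenius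
matching with a cuspidal π on GL_ℓ/ℚ). The hypothesis is a theorem on paper (ResidualRegularLift);
the content is lifting from HT weights (0,1,…,ℓ−1) to (0,…,0) at p = ℓ = n, foreseen as
ProAutomorphyBigRT (filed informal, rank 3) → ArtinWeightClassicality. [difficulty: open-problem] -/
@[route_item "route-Langlands-SteinbergArtinDedekind", crux]
def ArtinWeightLifting : Prop :=
  ∀ (ℓ : ℕ) [Fact ℓ.Prime], 5 ≤ ℓ → ∀ (ρ : Literature.NumberTheory.GaloisRepresentations.FramedGaloisRep ℚ (ZMod ℓ) 2) (σ : Literature.NumberTheory.GaloisRepresentations.FramedGaloisRep ℚ ℂ ℓ), Function.Surjective ρ → ρ.IsOdd → (∀ g, ((σ g : Matrix (Fin ℓ) (Fin ℓ) ℂ)).trace = ((Nat.card {w : Fin 2 → ZMod ℓ // w ≠ 0 ∧ ∃ a : ZMod ℓ, ((ρ g : Matrix (Fin 2) (Fin 2) (ZMod ℓ))).mulVec w = a • w} : ℂ)) / ((ℓ : ℂ) - 1) - 1) → (∃ (hcpt' : Literature.NumberTheory.Automorphic.isCompact_glFiniteIntegralLevel ℓ ℚ) (piR : Literature.NumberTheory.Automorphic.CuspidalAutomorphicRepData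 ℓ ℚ hcpt'), piR.1.HasWeightZero ∧ ∃ 𝔩 : Ideal ↥(integralClosure ℤ ℂ), 𝔩.IsMaximal ∧ ((ℓ : ℕ) : ↥(integralClosure ℤ ℂ)) ∈ 𝔩 ∧ ∀ᶠ v : IsDedekindDomain.HeightOneSpectrum (NumberField.RingOfIntegers ℚ) in Filter.cofinite, ∃ (P : Polynomial ↥(integralClosure ℤ ℂ)) (Q : Polynomial ℤ), piR.1.HasHeckePolynomialAt v (P.map (algebraMap ↥(integralClosure ℤ ℂ) ℂ)) ∧ σ.IsUnramifiedAt v ∧ σ.HasFrobCharpolyAt v (Q.map (Int.castRingHom ℂ)) ∧ P.map (Ideal.Quotient.mk 𝔩) = (Q.map (Int.castRingHom ↥(integralClosure ℤ ℂ))).map (Ideal.Quotient.mk 𝔩)) → ∃ (hcpt : Literature.NumberTheory.Automorphic.isCompact_glFiniteIntegralLevel ℓ ℚ) (π : Literature.NumberTheory.Automorphic.CuspidalAutomorphicRepData ℓ ℚ hcpt), ∀ᶠ v : IsDedekindDomain.HeightOneSpectrum (NumberField.RingOfIntegers ℚ) in Filter.cofinite, ∃ α : Multiset ℂ, π.1.HasSatakeParamAt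 v α ∧ σ.IsUnramifiedAt v ∧ σ.HasFrobCharpolyAt v (Literature.NumberTheory.Automorphic.satakePolynomial α)

-- item stmt-Langlands-12102 · crux · rank 3 · open · by planner — informal only, no Lean statement yet:
--   [crux] PRO-AUTOMORPHY AT WEIGHT −ρ / BIG R = 𝕋 AT p = n (card step (1) = S2; rank 3; first foreseen
--   child of ArtinWeightLifting). Fix ℓ ≥ 5, ρ̄ : Γ_ℚ ↠ GL₂(𝔽_ℓ) odd with ρ̄|G_ℚℓ irreducible (niveau
--   2), M/ℚ imaginary quadratic with ℓ split, S ⊇ {ℓ, primes where ρ̄ ramifies}; r̄ := Sym^(ℓ−1)ρ̄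
--   restricted to G_(M,S) (≅ σ̄ by SteinbergCongruence; RACSDC-automorphic by ResidualRegularLift +
--   quadratic base change; r̄(G_M(ζ_ℓ)) ⊇ PSL₂(𝔽_ℓ) acting on L(ℓ−1), adequate by
--   GuralnickHerzigTiep2017 Cor 9.4 / Thm 1.7). CLAIM: every irreducible component of Spec R^pol_S(r̄)
--   (polarized deformations, r^c ≅ r^∨

/-- item stmt-Langlands-11802 · crux · rank 4 · open · by planner
why it might fail: Unconditional only via Calegari2013ArtinS5 Thm 1.2, which needs L(ρ₅,s) ≠ 0 on (0,1) (not implied by GRH) to remove the density-zero set Ω ⊂ {Frob ∈ 4A} of Thm 4.7; the local condition at 5 is gone (odd Artin over totally real F is done, arXiv:2109.14145 p. 8), but nothing removes Ω for all odd ρ̄.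
sources: Calegari2013ArtinS5, arXiv:1112.1152, arXiv:2109.14145, Kim2002, KhareThorne2017, Booker2006
[crux] FIRST RUNG: the target at ℓ = 5 (PGL₂(𝔽₅) ≅ S₅; σ = Calegari's ρ₅): for every odd surjective
ρ̄ : Γ_ℚ → GL₂(𝔽₅), St∘ρ̄ is automorphic on GL₅/ℚ unconditionally. Calegari2013ArtinS5 Thm 1.2
proves it when the S₅-closure is unramified at 5 with Frob₅ ∈ 2B AND ζ_H(s) ≠ 0 for s ∈ (0,1), H the
degree-12 field (verified by Booker for one field); for ρ̄ = ρ̄_E,5 the closure contains ℚ(√5) and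
is ramified at 5, so even his hypotheses are not met. [difficulty: L] -/
@[route_item "route-Langlands-SteinbergArtinDedekind"]
def RungFive : Prop :=
  ∀ (ℓ : ℕ) [Fact ℓ.Prime], ℓ = 5 → ∀ (ρ : Literature.NumberTheory.GaloisRepresentations.FramedGaloisRep ℚ (ZMod ℓ) 2) (σ : Literature.NumberTheory.GaloisRepresentations.FramedGaloisRep ℚ ℂ ℓ), Function.Surjective ρ → ρ.IsOdd → (∀ g, ((σ g : Matrix (Fin ℓ) (Fin ℓ) ℂ)).trace = ((Nat.card {w : Fin 2 → ZMod ℓ // w ≠ 0 ∧ ∃ a : ZMod ℓ, ((ρ g : Matrix (Fin 2) (Fin 2) (ZMod ℓ))).mulVec w = a • w} : ℂ)) / ((ℓ : ℂ) - 1) - 1) → ∃ (hcpt : Literature.NumberTheory.Automorphic.isCompact_glFiniteIntegralLevel ℓ ℚ) (π : Literature.NumberTheory.Automorphic.CuspidalAutomorphicRepData ℓ ℚ hcpt), ∀ᶠ v : IsDedekindDomain.HeightOneSpectrum (NumberField.RingOfIntegers ℚ) in Filter.cofinite, ∃ α : Multiset ℂ, π.1.HasSatakeParamAt v α ∧ σ.IsUnramifiedAt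 v ∧ σ.HasFrobCharpolyAt v (Literature.NumberTheory.Automorphic.satakePolynomial α)

/-- item stmt-Langlands-11803 · crux · rank 5 · open · by planner
why it might fail: No S₅/icosahedral crutch: nothing beyond residual automorphy mod 7 is known for PGL₂(𝔽₇)-closures; even Artin holomorphy of ζ_K/ζ for these octic fields is open (no sub-solvable tower: Uchida–van der Waall do not apply), so a converse-theorem fallback is unavailable too.
sources: Calegari2013ArtinS5, NewtonThorneIHES2021b, GuralnickHerzigTiep2017, doi:10.1090/bull/1492
[crux] SECOND RUNG, the first with no exceptional isomorphism to an alternating/symmetric group: the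
target at ℓ = 7 — for every odd surjective ρ̄ : Γ_ℚ → GL₂(𝔽₇), St∘ρ̄ (dimension 7, projective image
PGL₂(𝔽₇)) is automorphic on GL₇/ℚ; equivalently ζ_K/ζ is a GL₇/ℚ standard L-function for the octic
7-isogeny fields K (first test: E = 11a1, the auditor's suggested L-function). Only the ℓ-adic door
is free here: PSL₂(𝔽₇) ≅ GL₃(𝔽₂) makes St₇ mod 2 = 1 + (V₃ ⊕ V₃*) Eisenstein (Brauer characters
(7,1,0,0) on the 2-regular classes), and St₇ mod 3 is the 7-dimensional irreducible of the defect-1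
principal block — neither is residually automorphic for free. [difficulty: open-problem] -/
@[route_item "route-Langlands-SteinbergArtinDedekind"]
def RungSeven : Prop :=
  ∀ (ℓ : ℕ) [Fact ℓ.Prime], ℓ = 7 → ∀ (ρ : Literature.NumberTheory.GaloisRepresentations.FramedGaloisRep ℚ (ZMod ℓ) 2) (σ : Literature.NumberTheory.GaloisRepresentations.FramedGaloisRep ℚ ℂ ℓ), Function.Surjective ρ → ρ.IsOdd → (∀ g, ((σ g : Matrix (Fin ℓ) (Fin ℓ) ℂ)).trace = ((Nat.card {w : Fin 2 → ZMod ℓ // w ≠ 0 ∧ ∃ a : ZMod ℓ, ((ρ g : Matrix (Fin 2) (Fin 2) (ZMod ℓ))).mulVec w = a • w} : ℂ)) / ((ℓ : ℂ) - 1) - 1) → ∃ (hcpt : Literature.NumberTheory.Automorphic.isCompact_glFiniteIntegralLevel ℓ ℚ) (π : Literature.NumberTheory.Automorphic.CuspidalAutomorphicRepData ℓ ℚ hcpt), ∀ᶠ v : IsDedekindDomain.HeightOneSpectrum (NumberField.RingOfIntegers ℚ) in Filter.cofinite, ∃ α : Multiset ℂ, π.1.HasSatakeParamAt v α ∧ σ.IsUnramifiedAt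 v ∧ σ.HasFrobCharpolyAt v (Literature.NumberTheory.Automorphic.satakePolynomial α)

/-- item stmt-Langlands-19093 · crux · rank 6 · open · by planner
why it might fail: Formalization debt, not mathematics (JS II Prop. 3.6 is a theorem): false AS TYPED only by a normalisation slip in the inlined text (q_w^(1−s₀) vs q_w^(s₀−1), unitary normalisation, α vs β⁻¹); ranks ≤ 2 of this exact text are proved in tree (…_pole_repData_rank_of_le_two).
sources: JacquetShalikaAJM1981II, ArthurClozelAMS120, JacquetShalikaAJM1981, ShahidiAJM1981, HumphriesJo2024, CogdellAnalyticTheory2004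
[crux] ARTHUR–CLOZEL (2.3) FOR BOREL–JACQUET DATA — PROMOTED LITERATURE INPUT of the junction's line
(route-choice 2026-08-17, unit rchoice-Summits-Langlands-Langlands-Cr-16a26670: the birth skeleton
Cruxes/SectorComplement/Lines/birth.lean of SectorComplement (stmt-Langlands-14623) consumed the
named fact Literature.NumberTheory.Automorphic.JacquetShalika1981_partialPairL_pole_repData as its
stub stub_pairLPoleJS; that fact is judged XL-apex — too large for one prover seat, and non-crux
Literature facts are not split — so it is promoted to an explicit crux of this route and the line is
rewired to this decl BY NAME). STATEMENT (Jacquet–Shalika II Prop. 3.6 = Arthur–Clozel Ch. 3 §2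
(2.3), p. 171, in the Borel–Jacquet model): for cuspidal π, π′ on GL_n(𝔸_F) (n ≥ 1, data
CuspidalAutomorphicRepData, arbitrary central characters) there is a finite S₀ such that for every
finite S ⊇ S₀, all Satake families α, β of π, π′ off S in unitary normalisation (‖∏α_w‖ = ‖∏β_w‖ =
1) and every s₀ on Re s = 1 IN X (q_w^(1−s₀)·α_w = β_w⁻¹ as multisets for almost all w: the
Hecke-matrix form of π ⊗ |·|^(s₀−1) ≅ σ̃), the limit of (s − s₀)·L^S(s, α × β) as s → s₀ with Re s >
1 exists and is NON-ZERO, wher -/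
@[route_item "route-Langlands-SteinbergArtinDedekind"]
def PairLPoleJS : Prop :=
  ∀ (n : ℕ) (F : Type) [Field F] [NumberField F] (hF : Literature.NumberTheory.Automorphic.isCompact_glFiniteIntegralLevel n F), 0 < n → ∀ (π π' : Literature.NumberTheory.Automorphic.CuspidalAutomorphicRepData n F hF), ∃ S₀ : Set (IsDedekindDomain.HeightOneSpectrum (NumberField.RingOfIntegers F)), S₀.Finite ∧ ∀ {S : Set (IsDedekindDomain.HeightOneSpectrum (NumberField.RingOfIntegers F))}, S.Finite → S₀ ⊆ S → ∀ {α β : IsDedekindDomain.HeightOneSpectrum (NumberField.RingOfIntegers F) → Multiset ℂ}, (∀ w ∉ S, π.1.HasSatakeParamAt w (α w)) → (∀ w ∉ S, π'.1.HasSatakeParamAt w (β w)) → (∀ w ∉ S, ‖(α w).prod‖ = 1) → (∀ w ∉ S, ‖(β w).prod‖ = 1) → ∀ {s₀ : ℂ}, s₀.re = 1 → (∀ᶠ w in cofinite, (α w).map ((((w.residueCard : ℂ) ^ (1 - s₀))) * ·) = (β w).map (·⁻¹)) → ∃ c : ℂ, c ≠ 0 ∧ Tendsto (fun s : ℂ =>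 (s - s₀) * ∏' w : {w : IsDedekindDomain.HeightOneSpectrum (NumberField.RingOfIntegers F) // w ∉ S}, ((Literature.NumberTheory.Automorphic.satakePairPolynomial (α w.1) (β w.1)).eval ((w.1.residueCard : ℂ) ^ (-s)))⁻¹) (𝓝[{s : ℂ | 1 < s.re}] s₀) (𝓝 c)

/-- item stmt-Langlands-11805 · crux (kind.auto-crux: conjecture-grade) · rank 9 · open · by planner
why it might fail: auto-crux — conjecture-grade statement (docstring avows it ('conjecture')); it is open, so it may simply be false
sources: KhareWintenberger2009, AshStevens1986, NewtonThorneIHES2021b, NewtonThorneIHES2021a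
[support] FREE RESIDUAL AUTOMORPHY: for ℓ ≥ 5, ρ̄ surjective odd, σ Steinberg-of-ρ̄, there is a
weight-zero cuspidal Π on GL_ℓ(𝔸_ℚ) congruent to σ modulo a prime over ℓ (= the hypothesis of
ArtinWeightLifting). On paper: ρ̄ ≅ ρ̄_g for a weight-2 newform g of level N(ρ̄)ℓ²
(KhareWintenberger2009; AshStevens1986 Thm 3.5), g non-CM (im ρ̄ ⊇ SL₂(𝔽_ℓ)); Π := Sym^(ℓ−1)π_g is
cuspidal of weight zero (NewtonThorneIHES2021b Thm A; HT 0,…,ℓ−1) with integral Hecke polynomial ≡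
Sym^(ℓ−1) charpoly ρ̄(Frob_p) ≡ charpoly σ(Frob_p) (SteinbergCongruence). Stated fact-free (no
named-fact hypotheses) to keep the cone clean; dischargeable in Lean once Serre's conjecture and
Sym^n automorphy are. [difficulty: L] -/
@[route_item "route-Langlands-SteinbergArtinDedekind", crux]
def ResidualRegularLift : Prop :=
  ∀ (ℓ : ℕ) [Fact ℓ.Prime], 5 ≤ ℓ → ∀ (ρ : Literature.NumberTheory.GaloisRepresentations.FramedGaloisRep ℚ (ZMod ℓ) 2) (σ : Literature.NumberTheory.GaloisRepresentations.FramedGaloisRep ℚ ℂ ℓ), Function.Surjective ρ → ρ.IsOdd → (∀ g, ((σ g : Matrix (Fin ℓ) (Fin ℓ) ℂ)).trace = ((Nat.card {w : Fin 2 → ZMod ℓ // w ≠ 0 ∧ ∃ a : ZMod ℓ, ((ρ g : Matrix (Fin 2) (Fin 2) (ZMod ℓ))).mulVec w = a • w} : ℂ)) / ((ℓ : ℂ) - 1) - 1) → ∃ (hcpt' : Literature.NumberTheory.Automorphic.isCompact_glFiniteIntegralLevel ℓ ℚ) (piR : Literature.NumberTheory.Automorphic.CuspidalAutomorphicRepData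 ℓ ℚ hcpt'), piR.1.HasWeightZero ∧ ∃ 𝔩 : Ideal ↥(integralClosure ℤ ℂ), 𝔩.IsMaximal ∧ ((ℓ : ℕ) : ↥(integralClosure ℤ ℂ)) ∈ 𝔩 ∧ ∀ᶠ v : IsDedekindDomain.HeightOneSpectrum (NumberField.RingOfIntegers ℚ) in Filter.cofinite, ∃ (P : Polynomial ↥(integralClosure ℤ ℂ)) (Q : Polynomial ℤ), piR.1.HasHeckePolynomialAt v (P.map (algebraMap ↥(integralClosure ℤ ℂ) ℂ)) ∧ σ.IsUnramifiedAt v ∧ σ.HasFrobCharpolyAt v (Q.map (Int.castRingHom ℂ)) ∧ P.map (Ideal.Quotient.mk 𝔩) = (Q.map (Int.castRingHom ↥(integralClosure ℤ ℂ))).map (Ideal.Quotient.mk 𝔩)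

/-- item stmt-Langlands-11808 · crux (kind.auto-crux: conjecture-grade) · rank 9 · open · by planner
why it might fail: auto-crux — summit-strength (notes:refuter-refute-pool-g44-39): the deciding theorem assumes it and nothing in the route derives it, so it is a bet, not glue
sources: BuzzardGeeLMS2014, FontaineMazurGeometric1995, ArthurClozelAMS120
[support] OUT-OF-SCOPE REMAINDER, filed only so that the deciding theorem honestly ends at the
summit: SteinbergStrongArtin → Langlands. It contains everything this thesis does NOT claim: in the
sector, the upgrade of a.e. Satake matching to `Corresponds` (local–global compatibility at every
finite place + strong multiplicity one) and the Galois side of (A) for the π produced; outside it,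
all other n, F, weights, direction (A) and the reciprocity data 𝓡. Never glue; not to be staffed
from this route; shared junction for any card on the Steinberg family. [difficulty: open-problem] -/
@[route_item "route-Langlands-SteinbergArtinDedekind", crux]
def SteinbergArtinJunction : Prop :=
  SteinbergStrongArtin → _root_.Langlands

/-- item stmt-Langlands-11804 · support · rank 9 · closed · proved by Summit.Langlands.Langlands.Theorems.SteinbergArtinDedekindSteinbergCongruence.steinbergCongruence (prover) · by planner
sources: Humphreys2005, GuralnickHerzigTiep2017, SerreLinearRepresentations1977
[support] DEFINING-CHARACTERISTIC MIRACLE (card claim (c)) in Brauer–Nesbitt-ready form: if σ has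
the Steinberg character of ρ̄ then for every g the characteristic polynomial of σ(g) lies in ℤ[X]
and reduces mod ℓ to ∏_(i=0)^(ℓ−1) (X − a^i b^(ℓ−1−i)), (a, b) the eigenvalues of ρ̄(g) in any field
over 𝔽_ℓ — i.e. σ̄^ss ≅ Sym^(ℓ−1)ρ̄ (St ⊗ 𝔽_ℓ = L(ℓ−1)). Finite group theory on the four class types
of GL₂(𝔽_ℓ); provable now. [difficulty: provable-now] -/
@[route_item "route-Langlands-SteinbergArtinDedekind"]
def SteinbergCongruence : Prop :=
  ∀ (ℓ : ℕ) [Fact ℓ.Prime] (ρ : Literature.NumberTheory.GaloisRepresentations.FramedGaloisRep ℚ (ZMod ℓ) 2) (σ : Literature.NumberTheory.GaloisRepresentations.FramedGaloisRep ℚ ℂ ℓ), (∀ g, ((σ g : Matrix (Fin ℓ) (Fin ℓ) ℂ)).trace = ((Nat.card {w : Fin 2 → ZMod ℓ // w ≠ 0 ∧ ∃ a : ZMod ℓ, ((ρ g : Matrix (Fin 2) (Fin 2) (ZMod ℓ))).mulVec w = a • w} : ℂ)) / ((ℓ : ℂ) - 1) - 1) → ∀ g, ∃ Q : Polynomial ℤ,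 Q.map (Int.castRingHom ℂ) = Literature.NumberTheory.GaloisRepresentations.FramedRep.charpoly σ g ∧ ∀ (k : Type) [Field k] [Algebra (ZMod ℓ) k] (a b : k), (Literature.NumberTheory.GaloisRepresentations.FramedRep.charpoly ρ g).map (algebraMap (ZMod ℓ) k) = (Polynomial.X - Polynomial.C a) * (Polynomial.X - Polynomial.C b) → Q.map (Int.castRingHom k) = ∏ i ∈ Finset.range ℓ, (Polynomial.X - Polynomial.C (a ^ i * b ^ (ℓ - 1 - i)))

-- `SteinbergCongruence` holds: proved by `Summit.Langlands.Langlands.Theorems.SteinbergArtinDedekindSteinbergCongruence.steinbergCongruence` (its module imports this route file, so no `_holds` link can be stated here).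

/-- item stmt-Langlands-11806 · support · rank 9 · closed · proved by Summit.Langlands.Langlands.Theorems.SteinbergArtinDedekindSteinbergArtinExists.steinbergArtinExists (prover) · by planner
sources: SerreLinearRepresentations1977, Humphreys2005
[support] CONSTRUCTION (never smuggled into the interface): for every continuous ρ̄ : Γ_ℚ → GL₂(𝔽_ℓ)
there is a continuous σ : Γ_ℚ → GL_ℓ(ℂ) with the Steinberg character of ρ̄ — σ = (ℂ[P¹(𝔽_ℓ)] ⊖ 𝟙)∘ρ̄
in any basis; continuity because ρ̄ has open kernel. Makes the family non-empty; the character pins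
σ up to GL_ℓ(ℂ)-conjugacy. [difficulty: provable-now] -/
@[route_item "route-Langlands-SteinbergArtinDedekind"]
def SteinbergArtinExists : Prop :=
  ∀ (ℓ : ℕ) [Fact ℓ.Prime] (ρ : Literature.NumberTheory.GaloisRepresentations.FramedGaloisRep ℚ (ZMod ℓ) 2), ∃ σ : Literature.NumberTheory.GaloisRepresentations.FramedGaloisRep ℚ ℂ ℓ, (∀ g, ((σ g : Matrix (Fin ℓ) (Fin ℓ) ℂ)).trace = ((Nat.card {w : Fin 2 → ZMod ℓ // w ≠ 0 ∧ ∃ a : ZMod ℓ, ((ρ g : Matrix (Fin 2) (Fin 2) (ZMod ℓ))).mulVec w = a • w} : ℂ)) / ((ℓ : ℂ) - 1) - 1)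

-- `SteinbergArtinExists` holds: proved by `Summit.Langlands.Langlands.Theorems.SteinbergArtinDedekindSteinbergArtinExists.steinbergArtinExists` (its module imports this route file, so no `_holds` link can be stated here).

/-- item stmt-Langlands-11807 · support · rank 9 · open · by planner
sources: Calegari2013ArtinS5, Kim2002, doi:10.1007/s00222-018-0825-x, doi:10.4171/dm/419
[support] CALIBRATION (ℓ = 5, weak form): for odd surjective ρ̄ : Γ_ℚ → GL₂(𝔽₅) there is a cuspidal
ϖ on GL₅/ℚ matching σ = St∘ρ̄ at a set of finite places of natural density one. Calegari2013ArtinS5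
Thm 1.1 gives this for closures unramified at 5 with Frob₅ ∈ 2B and says the local condition at 5
'is not essential to the method'; it entered through Sasaki's theorems and should disappear with
Pilloni–Stroh 2016 / Sasaki 2019 (p ramified allowed). Known on paper modulo that substitution; the
rung below RungFive. [difficulty: M] -/
@[route_item "route-Langlands-SteinbergArtinDedekind"]
def RungFiveWeak : Prop :=
  ∀ (ℓ : ℕ) [Fact ℓ.Prime], ℓ = 5 → ∀ (ρ : Literature.NumberTheory.GaloisRepresentations.FramedGaloisRep ℚ (ZMod ℓ) 2) (σ : Literature.NumberTheory.GaloisRepresentations.FramedGaloisRep ℚ ℂ ℓ), Function.Surjective ρ → ρ.IsOdd → (∀ g, ((σ g : Matrix (Fin ℓ) (Fin ℓ) ℂ)).trace = ((Nat.card {w : Fin 2 → ZMod ℓ // w ≠ 0 ∧ ∃ a : ZMod ℓ, ((ρ g : Matrix (Fin 2) (Fin 2) (ZMod ℓ))).mulVec w = a • w} : ℂ)) / ((ℓ : ℂ) - 1) - 1) → ∃ (hcpt : Literature.NumberTheory.Automorphic.isCompact_glFiniteIntegralLevel ℓ ℚ) (π : Literature.NumberTheory.Automorphic.CuspidalAutomorphicRepData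 ℓ ℚ hcpt), Filter.Tendsto (fun x : ℕ => (Nat.card {v : IsDedekindDomain.HeightOneSpectrum (NumberField.RingOfIntegers ℚ) // v.residueCard ≤ x ∧ ∃ α : Multiset ℂ, π.1.HasSatakeParamAt v α ∧ σ.IsUnramifiedAt v ∧ σ.HasFrobCharpolyAt v (Literature.NumberTheory.Automorphic.satakePolynomial α)} : ℝ) / (Nat.card {v : IsDedekindDomain.HeightOneSpectrum (NumberField.RingOfIntegers ℚ) // v.residueCard ≤ x} : ℝ)) Filter.atTop (nhds 1)

/-- item stmt-Langlands-11809 · assembly · rank 1 · closed · proved by Summit.Langlands.Langlands.Theorems.steinbergArtinDedekind_assembly_proof (prover) · by planner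
sources: Calegari2013ArtinS5, NewtonThorneIHES2021b, BuzzardGeeLMS2014
[assembly] ArtinWeightLifting → ResidualRegularLift → SteinbergArtinJunction → Langlands. -/
@[route_item "route-Langlands-SteinbergArtinDedekind"]
def Assembly : Prop :=
  ArtinWeightLifting → ResidualRegularLift → SteinbergArtinJunction → _root_.Langlands

-- `Assembly` holds: proved by `Summit.Langlands.Langlands.Theorems.steinbergArtinDedekind_assembly_proof` (its module imports this route file, so no `_holds` link can be stated here).

/-! D-0027 §2.1 — DECIDING THEOREM (planner-authored via `route open/edit --closes-file`; by planner-plancard-Langlands-Langlands-steinber-ca742ef6-g2-0 2026-08-15T18:43:56Z):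
its hypotheses are this route's items and its conclusion the sub-problem Statement (glue_lint), and it elaborates with this file. -/

@[closes "route-Langlands-SteinbergArtinDedekind"] theorem closes (hLift : ArtinWeightLifting) (hRes : ResidualRegularLift)
    (hJ : SteinbergArtinJunction) : _root_.Langlands :=
  hJ (fun ℓ _ hℓ ρ σ hsurj hodd hchar =>
    hLift ℓ hℓ ρ σ hsurj hodd hchar (hRes ℓ hℓ ρ σ hsurj hodd hchar))

end Summit.Langlands.Langlands.Theses.SteinbergArtinDedekind
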